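import Summits.CriticalPhenomena.PercolationContinuityZ3.Theorems.PercNearOneGluingNoHeavyQuantForestBridge
import Summits.CriticalPhenomena.PercolationContinuityZ3.Theorems.PercNearOneGluingNoHeavyQuantTwoRootGateCoupling
import HarnessLib

/-!
# QUANT lane R8, T-DEC: THE COMPOUND CUT (k-general) — the sibling step for a forest `carrier :: compound` REDUCES, inside the induction,
# to ONE law: the conditioned compound with the carrier hung under it (`β_L ∗ gate_{q_k/Q_L} ρ_k`); the width-(k−1) part is FREE by the oracle

builds on p205010 (kernel theorem, internal audit signed; external expert review pending)

Support + definition file (`--supports stmt-CriticalPhenomena-4575`), QUANT lane seat prim-quant-arm-1 (gen 47, architect), rung R8 of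
`run/shared/lean/prim/quant/LADDER.md`; memo `run/shared/lean/prim/quant/prim-quant-arm-1-g47/ARCH-G47.md` §1–§2.  Definitions: the list
functionals `fQ` (probability that some root of the forest is open) and `fbeta` (the forest law CONDITIONED on some root open — the "opened
compound"); theorems with standard axioms, no sorries.  Uses the list binder of typer g39 (`…QuantForestData` / `…QuantForestBridge`: `Sib`,
`flaw`, `fmean`, `ftop`, `fgates`, `Sib.TreeOK`) and arm-1 g45's two-root identity (`…QuantTwoRootGateCoupling`: `twoRoot_gateCoupling`).

THE CUT (arm-1 g46 ARCH-LIGHT-G46 §8, made k-general and put in the kernel here).  For a forest `flaw (sk :: L)` = carrier tree `gate ρ_k q_k` beside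
the compound forest `flaw L` of the other `k−1` trees: `flaw L = gate (fbeta L) (fQ L)` (`fQ L = 1 − Π(1−qᵢ)`), so the forest is a TWO-ROOT forest
with hub = the compound (`q_k ≤ fQ L`), and the two-root identity gives
  `gate_a(flaw (sk :: L)) = w·[gate_a(flaw L) ∗ gate_{a q_k} ρ_k] + (1−w)·gate_{a·fQ L}[fbeta L ∗ gate_{q_k/fQ L} ρ_k]`, `w = (1−fQ L)/(1−a·fQ L)`.
The first component (P-part) is FREE inside `SiblingStep`: `flaw L` is tree-built with FEWER nontrivial gates than the whole forest, hence SDEC by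
the ORACLE (no width-(k−1) certificate is needed), `ρ_k` likewise, and the product is DEC at the summed target by `convClosedT_holds` ✓.  So the
k-sibling step holds for `sk :: L` as soon as the single law `fbeta L ∗ gate_{q_k/fQ L} ρ_k` — the conditioned compound with the carrier riding
along at its exact marginal — is SDEC at a floor `w_U` with `x ≤ fQ L · w_U` ("PROBLEM(L_{k−1}, S′)" of the memo; arm-1 g47's BUBBLE recursion
solves it in closed form on an explicit region, file `…QuantBubbleFamily`).

* `fQ`, `fbeta`; `fQ_facts`, `flaw_zero_ge`, `flaw_eq_gate_fbeta`, `fbeta_laws` (a probability law on `{0..ftop L}` of mean `fmean L / fQ L`),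
  `flaw_treeBuiltN` (the compound forest is tree-built at the forest floor with `fgates L` gates).
* `decAt_twoRoot_of_gatedHub` — arm-1 g45's `decAt_twoRoot_of_opened` with the hub's SDEC hypothesis weakened to "the hub tree gated by `a·q₁` is
  DEC at every layer" (all the proof uses; needed because `fbeta L` is only known SDEC up to the gate `fQ L`).
* **`decAt_gate_flaw_cons_of_upart`** / **`sdec_flaw_cons_of_upart`**: `TreeOK` carrier and compound, oracle below `fgates (sk :: L)`, `sk.q ≤ fQ L`,
  and `SDEC w_U (ftop L + sk.M) (lconv (fbeta L) (gate sk.ρ (sk.q / fQ L)))` with `x ≤ fQ L · w_U` ⟹ `SDEC x (ftop (sk :: L)) (flaw (sk :: L))`.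

HONEST STATUS: a reduction, not a proof of the node; `SiblingStep`, `GateStepN`, `FarTreeRow` OPEN; RATE class log\* / honest sentence unchanged.
[this work]; two-root identity: prim-quant-arm-1 g45; recursion: prim-quant-arm-1 g46 §8; list binder: prim-quant-stmt g39.  Nothing here is cited
as a published result.  The gluing rows served [cite: KozmaNitzan2024, Conjecture 3 (p. 15)]; product measure [cite: Grimmett1999, §1.3 p. 10].
-/

noncomputable section

open scoped BigOperators

namespace Summit.CriticalPhenomena.PercolationContinuityZ3.Theorems
namespace Quant
namespace LawDec

open Finset

/-! ### The conditioned compound -/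

/-- `fQ L = 1 − Π (1 − qᵢ)`: the probability that at least one root of the forest is open. [this work] -/
def fQ : List Sib → ℝ
  | [] => 0
  | s :: L => fQ L + s.q * (1 - fQ L)

/-- **the opened compound** `fbeta L`: the forest law conditioned on "some root open", `(flaw L − (1 − fQ L)·δ₀) / fQ L`. [this work] -/
def fbeta (L : List Sib) : ℕ → ℝ := fun h => (flaw L h - (1 - fQ L) * (if h = 0 then (1 : ℝ) else 0)) / fQ L

/-- `0 ≤ fQ L ≤ 1`, `fQ L < 1`, and `q ≤ fQ L` for every member (hence `0 < fQ L` for `L ≠ []`). [this work] -/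
theorem fQ_facts (L : List Sib) (hL : ∀ s ∈ L, s.LawOK) :
    0 ≤ fQ L ∧ fQ L < 1 ∧ (∀ s ∈ L, s.q ≤ fQ L) := by
  induction L with
  | nil => exact ⟨le_rfl, by simp [fQ], fun s hs => by simp at hs⟩
  | cons s L ih =>
    obtain ⟨hq0, hq1, _, _, _⟩ := hL s List.mem_cons_self
    obtain ⟨h0, h1, hmem⟩ := ih (fun t ht => hL t (List.mem_cons_of_mem s ht))
    refine ⟨by simp only [fQ]; nlinarith, by simp only [fQ]; nlinarith, fun t ht => ?_⟩
    simp only [fQ]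
    rcases List.mem_cons.1 ht with rfl | ht
    · nlinarith
    · have := hmem t ht; nlinarith

/-- the forest law charges `0` at least with the "all roots closed" mass: `1 − fQ L ≤ flaw L 0`. [this work] -/
theorem flaw_zero_ge (L : List Sib) (hL : ∀ s ∈ L, s.LawOK) : 1 - fQ L ≤ flaw L 0 := by
  induction L with
  | nil => simp [fQ, flaw]
  | cons s L ih =>
    obtain ⟨hq0, hq1, ρ0, ρM, ρ1⟩ := hL s List.mem_cons_self
    have hL' : ∀ t ∈ L, t.LawOK := fun t ht => hL t (List.mem_cons_of_mem s ht)
    obtain ⟨f0, fM, _, _⟩ := flaw_facts L hL'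
    have h := ih hL'
    simp only [flaw, fQ]
    rw [lconv_gate_right _ _ _ _ _ fM 0]
    have hc : 0 ≤ lconv (ftop L) s.M (flaw L) s.ρ 0 := lconv_nonneg _ _ _ _ f0 ρ0 0
    nlinarith

/-- **the forest is the opened compound under the gate `fQ L`**: `flaw L = gate (fbeta L) (fQ L)` (`L ≠ []`). [this work] -/
theorem flaw_eq_gate_fbeta (L : List Sib) (hL : ∀ s ∈ L, s.LawOK) (hne : L ≠ []) (h : ℕ) :
    flaw L h = gate (fbeta L) (fQ L) h := by
  obtain ⟨_, _, hmem⟩ := fQ_facts L hL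
  have hQ0 : 0 < fQ L := by
    obtain ⟨s, hs⟩ := List.exists_mem_of_ne_nil L hne
    exact lt_of_lt_of_le (hL s hs).1 (hmem s hs)
  rw [gate_apply]
  simp only [fbeta]
  rw [mul_div_cancel₀ _ hQ0.ne']
  ring

/-- **law facts of the opened compound** (`L ≠ []`): nonnegative, vanishing above `ftop L`, mass `1`, mean `fmean L / fQ L`. [this work] -/
theorem fbeta_laws (L : List Sib) (hL : ∀ s ∈ L, s.LawOK) (hne : L ≠ []) :
    (∀ h, 0 ≤ fbeta L h) ∧ (∀ h, ftop L < h → fbeta L h = 0) ∧ (∑ h ∈ Finset.range (ftop L + 1), fbeta L h = 1) ∧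
      ∑ h ∈ Finset.range (ftop L + 1), (h : ℝ) * fbeta L h = fmean L / fQ L := by
  obtain ⟨_, hQ1, hmem⟩ := fQ_facts L hL
  have hQ0 : 0 < fQ L := by
    obtain ⟨s, hs⟩ := List.exists_mem_of_ne_nil L hne
    exact lt_of_lt_of_le (hL s hs).1 (hmem s hs)
  obtain ⟨f0, fM, f1, fmn⟩ := flaw_facts L hL
  have hz := flaw_zero_ge L hL
  refine ⟨fun h => ?_, fun h hh => ?_, ?_, ?_⟩
  · simp only [fbeta]
    refine div_nonneg ?_ hQ0.le
    by_cases h0 : h = 0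
    · subst h0; rw [if_pos rfl]; linarith
    · rw [if_neg h0, mul_zero, sub_zero]; exact f0 h
  · simp only [fbeta]; rw [fM h hh, if_neg (by omega)]; ring
  · simp only [fbeta]
    rw [← Finset.sum_div, Finset.sum_sub_distrib, f1, ← Finset.mul_sum, Finset.sum_ite_eq' (Finset.range (ftop L + 1)) 0,
      if_pos (Finset.mem_range.2 (Nat.succ_pos _))]
    field_simp
    ring
  · simp only [fbeta]
    have e : ∀ h : ℕ, (h : ℝ) * ((flaw L h - (1 - fQ L) * (if h = 0 then (1 : ℝ) else 0)) / fQ L)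
        = ((h : ℝ) * flaw L h) / fQ L - ((1 - fQ L) / fQ L) * ((h : ℝ) * (if h = 0 then (1 : ℝ) else 0)) := fun h => by ring
    simp_rw [e]
    rw [Finset.sum_sub_distrib, ← Finset.sum_div, fmn, ← Finset.mul_sum]
    have hz' : ∑ h ∈ Finset.range (ftop L + 1), (h : ℝ) * (if h = 0 then (1 : ℝ) else 0) = 0 := by
      refine Finset.sum_eq_zero fun h _ => ?_
      split_ifs with h0
      · rw [h0, Nat.cast_zero, zero_mul]
      · rw [mul_zero]
    rw [hz', mul_zero, sub_zero]

/-- **the compound forest is tree-built at the forest floor with `fgates L` nontrivial gates.** [this work] -/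
theorem flaw_treeBuiltN {x : ℝ} (hx0 : 0 < x) (hx1 : x < 1) (L : List Sib) (hL : ∀ s ∈ L, s.TreeOK x) :
    TreeBuiltN x (fgates L) (ftop L) (flaw L) :=
  (compForestN_of_list hx0 hx1 L hL).treeBuiltN

/-! ### The two-tree gate step with a gated (rather than SDEC) hub -/

/-- **THE TWO-TREE GATE STEP, HUB GIVEN ONLY UNDER ITS GATE.**  As arm-1 g45's `decAt_twoRoot_of_opened`, but the hub law `ρ₁` (a top-affordable
probability law at a floor `y₁`) is only assumed DEC at every layer AFTER gating by `a·q₁` (at floor `a·q₁·y₁`) — which is all that proof uses; the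
other tree `ρ₂` SDEC at `y₂`, root gates `0 < q₂ ≤ q₁ < 1`, the forest `ρ₁ ⊔ gate_{q₂/q₁}ρ₂` SDEC at `w_G`, outer gate `0 < a ≤ 1`, floor `0 < z` below
`a q₁ y₁`, `a q₂ y₂`, `a q₁ w_G` ⟹ `gate_a(gate_{q₁}ρ₁ ∗ gate_{q₂}ρ₂)` is DEC(j) at floor `z` for every `j < M₁ + M₂`. [this work] -/
theorem decAt_twoRoot_of_gatedHub (y₁ y₂ wG z q₁ q₂ a : ℝ) (M₁ M₂ : ℕ) (ρ₁ ρ₂ : ℕ → ℝ)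
    (hy₁0 : 0 < y₁) (hy₁1 : y₁ < 1) (hy₂0 : 0 < y₂) (hy₂1 : y₂ < 1) (hwG0 : 0 ≤ wG) (hwG1 : wG < 1)
    (hq₂0 : 0 < q₂) (hq₂₁ : q₂ ≤ q₁) (hq₁1 : q₁ < 1) (ha0 : 0 < a) (ha1 : a ≤ 1) (hz0 : 0 < z)
    (h₁0 : ∀ h, 0 ≤ ρ₁ h) (h₁M : ∀ h, M₁ < h → ρ₁ h = 0) (h₁1 : ∑ h ∈ Finset.range (M₁ + 1), ρ₁ h = 1)
    (hta₁ : y₁ * (M₁ : ℝ) ≤ ∑ h ∈ Finset.range (M₁ + 1), (h : ℝ) * ρ₁ h)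
    (h₂0 : ∀ h, 0 ≤ ρ₂ h) (h₂M : ∀ h, M₂ < h → ρ₂ h = 0) (h₂1 : ∑ h ∈ Finset.range (M₂ + 1), ρ₂ h = 1)
    (hta₂ : y₂ * (M₂ : ℝ) ≤ ∑ h ∈ Finset.range (M₂ + 1), (h : ℝ) * ρ₂ h)
    (hD₁ : ∀ j'', j'' < M₁ → DECAt (a * q₁ * y₁) j'' M₁ (gate ρ₁ (a * q₁))) (hS₂ : SDEC y₂ M₂ ρ₂)
    (hG : SDEC wG (M₁ + M₂) (lconv M₁ M₂ ρ₁ (gate ρ₂ (q₂ / q₁))))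
    (hz₁ : z ≤ a * q₁ * y₁) (hz₂ : z ≤ a * q₂ * y₂) (hzG : z ≤ a * q₁ * wG)
    (j : ℕ) (hj : j < M₁ + M₂) :
    DECAt z j (M₁ + M₂) (gate (lconv M₁ M₂ (gate ρ₁ q₁) (gate ρ₂ q₂)) a) := by
  have hq₁0 : 0 < q₁ := lt_of_lt_of_le hq₂0 hq₂₁
  have haq₁0 : 0 < a * q₁ := mul_pos ha0 hq₁0
  have haq₁1 : a * q₁ < 1 := by nlinarith
  have haq₂0 : 0 < a * q₂ := mul_pos ha0 hq₂0
  have haq₂1 : a * q₂ ≤ 1 := by nlinarith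
  have hr0 : 0 < q₂ / q₁ := div_pos hq₂0 hq₁0
  have hr1 : q₂ / q₁ ≤ 1 := by rw [div_le_one hq₁0]; exact hq₂₁
  have hz1 : z < 1 := by nlinarith
  set S₁ : ℝ := ∑ h ∈ Finset.range (M₁ + 1), (h : ℝ) * ρ₁ h with hS₁def
  set S₂ : ℝ := ∑ h ∈ Finset.range (M₂ + 1), (h : ℝ) * ρ₂ h with hS₂def
  set w : ℝ := (1 - q₁) / (1 - a * q₁) with hwdef
  have hw0 : 0 ≤ w := div_nonneg (by linarith) (by linarith)
  have hw1 : w ≤ 1 := by rw [hwdef, div_le_one (by linarith)]; nlinarith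
  set TE : ℝ := a * (q₁ * S₁ + q₂ * S₂) with hTEdef
  obtain ⟨g₁0, g₁M, g₁1⟩ := gate_laws M₁ ρ₁ (a * q₁) haq₁0.le haq₁1.le h₁0 h₁M h₁1
  obtain ⟨g₂0, g₂M, g₂1⟩ := gate_laws M₂ ρ₂ (a * q₂) haq₂0.le haq₂1 h₂0 h₂M h₂1
  -- component P: plain convolution of the two independently scaled roots — ConvClosedT
  have hP : DECAtT z TE j (M₁ + M₂) (lconv M₁ M₂ (gate ρ₁ (a * q₁)) (gate ρ₂ (a * q₂))) := by
    have d₁ : ∀ j'', DECAtT z (a * q₁ * S₁) j'' M₁ (gate ρ₁ (a * q₁)) := by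
      intro j''
      have d : DECAt (a * q₁ * y₁) j'' M₁ (gate ρ₁ (a * q₁)) := by
        by_cases hjM : j'' < M₁
        · exact hD₁ j'' hjM
        · exact decAt_gate_of_top_le M₁ ρ₁ y₁ (a * q₁) hy₁0.le (by nlinarith) haq₁0.le haq₁1.le h₁0 h₁M h₁1 hta₁ j''
            (not_lt.1 hjM)
      have d' := decAt_mono_floor hz₁ (by nlinarith) d
      rwa [decAt_iff_decAtT, sum_mul_gate] at d'
    have d₂ : ∀ j'', DECAtT z (a * q₂ * S₂) j'' M₂ (gate ρ₂ (a * q₂)) := by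
      intro j''
      have d : DECAt (a * q₂ * y₂) j'' M₂ (gate ρ₂ (a * q₂)) := by
        by_cases hjM : j'' < M₂
        · exact hS₂ (a * q₂) haq₂0 haq₂1 j'' hjM
        · exact decAt_gate_of_top_le M₂ ρ₂ y₂ (a * q₂) hy₂0.le (by nlinarith) haq₂0.le haq₂1 h₂0 h₂M h₂1 hta₂ j''
            (not_lt.1 hjM)
      have d' := decAt_mono_floor hz₂ (by nlinarith) d
      rwa [decAt_iff_decAtT, sum_mul_gate] at d'
    have hC := convClosedT_holds z (a * q₁ * S₁) (a * q₂ * S₂) M₁ M₂ j (gate ρ₁ (a * q₁)) (gate ρ₂ (a * q₂)) hz0 hz1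
      g₁0 g₁M g₁1 g₂0 g₂M g₂1 hj (fun j'' _ _ => d₁ j'') (fun j'' _ _ => d₂ j'')
    have e : a * q₁ * S₁ + a * q₂ * S₂ = TE := by rw [hTEdef]; ring
    rwa [e] at hC
  -- component U: the opened forest under the merged gate `a q₁`
  have hU : DECAtT z TE j (M₁ + M₂) (gate (lconv M₁ M₂ ρ₁ (gate ρ₂ (q₂ / q₁))) (a * q₁)) := by
    have d := hG (a * q₁) haq₁0 haq₁1.le j hj
    have d' := decAt_mono_floor hzG (by nlinarith) d
    obtain ⟨r0, rM, r1⟩ := gate_laws M₂ ρ₂ (q₂ / q₁) hr0.le hr1 h₂0 h₂M h₂1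
    rw [decAt_iff_decAtT, sum_mul_gate, sum_mul_lconv M₁ M₂ ρ₁ _ h₁1 r1, sum_mul_gate] at d'
    have e : a * q₁ * (S₁ + q₂ / q₁ * S₂) = TE := by rw [hTEdef]; field_simp
    rwa [e] at d'
  have mix := decAtT_mixture w hw0 hw1 hP hU
  have e : gate (lconv M₁ M₂ (gate ρ₁ q₁) (gate ρ₂ q₂)) a
      = fun h => w * lconv M₁ M₂ (gate ρ₁ (a * q₁)) (gate ρ₂ (a * q₂)) h
          + (1 - w) * gate (lconv M₁ M₂ ρ₁ (gate ρ₂ (q₂ / q₁))) (a * q₁) h := by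
    funext h
    rw [hwdef]
    exact twoRoot_gateCoupling M₁ M₂ ρ₁ ρ₂ q₁ q₂ a h₁M h₂M hq₁0.ne' (by linarith) h
  obtain ⟨t₁0, t₁M, t₁1⟩ := gate_laws M₁ ρ₁ q₁ hq₁0.le hq₁1.le h₁0 h₁M h₁1
  obtain ⟨t₂0, t₂M, t₂1⟩ := gate_laws M₂ ρ₂ q₂ hq₂0.le (hq₂₁.trans hq₁1.le) h₂0 h₂M h₂1
  have hEmean : ∑ h ∈ Finset.range (M₁ + M₂ + 1), (h : ℝ) * gate (lconv M₁ M₂ (gate ρ₁ q₁) (gate ρ₂ q₂)) a h = TE := by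
    rw [sum_mul_gate, sum_mul_lconv M₁ M₂ _ _ t₁1 t₂1, sum_mul_gate, sum_mul_gate, hTEdef]
  rw [decAt_iff_decAtT, hEmean, e]
  exact mix

/-! ### THE COMPOUND CUT -/

/-- **THE COMPOUND CUT (k-general): the sibling step for `carrier :: compound` from the conditioned-compound law alone.**  For a floor
`0 < x < 1`, a tree-built carrier sibling `sk` and a NON-EMPTY compound list `L` of tree-built siblings (`Sib.TreeOK x`), GIVEN the oracle "every
tree-built law with fewer than `fgates (sk :: L)` nontrivial gates is SDEC" (the induction hypothesis of `SiblingStep`), the hub condition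
`sk.q ≤ fQ L`, an outer gate `0 < a ≤ 1`, and SDEC of the ONE law `fbeta L ∗ gate_{sk.q / fQ L} sk.ρ` (the opened compound with the carrier hung under
it) at a floor `w_U` with `x ≤ fQ L · w_U`: the gated forest `gate (flaw (sk :: L)) a` is DEC at floor `a·x` at every layer.  The P-part
`gate_a(flaw L) ∗ gate_{a·sk.q} sk.ρ` is certified by the oracle on the compound forest (fewer gates) and on the carrier, and `convClosedT_holds`. [this work] -/
theorem decAt_gate_flaw_cons_of_upart {x a : ℝ} (hx0 : 0 < x) (hx1 : x < 1) (sk : Sib) (L : List Sib)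
    (hk : sk.TreeOK x) (hL : ∀ s ∈ L, s.TreeOK x) (hne : L ≠ [])
    (hO : ∀ (x' : ℝ) (n' M' : ℕ) (μ' : ℕ → ℝ), n' < fgates (sk :: L) → TreeBuiltN x' n' M' μ' → SDEC x' M' μ')
    (hhub : sk.q ≤ fQ L) (ha0 : 0 < a) (ha1 : a ≤ 1) (wU : ℝ) (hwU0 : 0 ≤ wU) (hwU1 : wU < 1)
    (hU : SDEC wU (ftop L + sk.M) (lconv (ftop L) sk.M (fbeta L) (gate sk.ρ (sk.q / fQ L))))
    (hxU : x ≤ fQ L * wU) :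
    ∀ j, j < ftop (sk :: L) → DECAt (a * x) j (ftop (sk :: L)) (gate (flaw (sk :: L)) a) := by
  intro j hj
  obtain ⟨hq0, hq1, hxq, hT, _⟩ := hk
  obtain ⟨hx₁0, hx₁1, ρ0, ρM, ρ1, ρta⟩ := hT.lawFacts
  have hL' : ∀ s ∈ L, s.LawOK := fun s hs => (hL s hs).lawOK
  obtain ⟨_, hQ1, hmem⟩ := fQ_facts L hL'
  have hQ0 : 0 < fQ L := lt_of_lt_of_le hq0 hhub
  obtain ⟨b0, bM, b1, bmean⟩ := fbeta_laws L hL' hne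
  have hF := flaw_treeBuiltN hx0 hx1 L hL
  obtain ⟨_, _, _, _, _, fta⟩ := hF.lawFacts
  obtain ⟨_, _, _, fmn⟩ := flaw_facts L hL'
  -- the hub floor `y₁ = x / fQ L`
  have hxQ : x < fQ L := by
    obtain ⟨s, hs⟩ := List.exists_mem_of_ne_nil L hne
    obtain ⟨sq0, sq1, sxq, sT, _⟩ := hL s hs
    obtain ⟨_, sx₁1, _, _, _, _⟩ := sT.lawFacts
    have : x < s.q := by nlinarith
    exact lt_of_lt_of_le this (hmem s hs)
  have hy0 : 0 < x / fQ L := div_pos hx0 hQ0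
  have hy1 : x / fQ L < 1 := by rw [div_lt_one hQ0]; exact hxQ
  have hta₁ : x / fQ L * (ftop L : ℝ) ≤ ∑ h ∈ Finset.range (ftop L + 1), (h : ℝ) * fbeta L h := by
    rw [bmean, div_mul_eq_mul_div, div_le_div_iff_of_pos_right hQ0, ← fmn]
    exact fta
  -- the hub gated by `a · fQ L` is the compound forest gated by `a`: oracle
  have hD₁ : ∀ j'', j'' < ftop L → DECAt (a * fQ L * (x / fQ L)) j'' (ftop L) (gate (fbeta L) (a * fQ L)) := by
    intro j'' hj''
    have hS : SDEC x (ftop L) (flaw L) := hO x (fgates L) (ftop L) (flaw L) (by simp only [fgates]; omega) hF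
    have d := hS a ha0 ha1 j'' hj''
    have e : gate (flaw L) a = gate (fbeta L) (a * fQ L) := by
      funext h
      rw [show gate (flaw L) a h = gate (gate (fbeta L) (fQ L)) a h by
        simp only [gate]; rw [flaw_eq_gate_fbeta L hL' hne h]; rfl]
      rw [gate_gate]
    rw [e, show a * x = a * fQ L * (x / fQ L) by field_simp] at d
    exact d
  have hS₂ : SDEC sk.x₁ sk.M sk.ρ := hO sk.x₁ sk.n sk.M sk.ρ (by simp only [fgates]; omega) hT
  have e : gate (flaw (sk :: L)) a = gate (lconv (ftop L) sk.M (gate (fbeta L) (fQ L)) (gate sk.ρ sk.q)) a := by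
    have : flaw L = gate (fbeta L) (fQ L) := funext fun h => flaw_eq_gate_fbeta L hL' hne h
    simp only [flaw]; rw [this]
  have htop : ftop (sk :: L) = ftop L + sk.M := by simp only [ftop]
  rw [e, htop]
  rw [htop] at hj
  exact decAt_twoRoot_of_gatedHub (x / fQ L) sk.x₁ wU (a * x) (fQ L) sk.q a (ftop L) sk.M (fbeta L) sk.ρ hy0 hy1 hx₁0 hx₁1 hwU0 hwU1
    hq0 hhub hQ1 ha0 ha1 (mul_pos ha0 hx0) b0 bM b1 hta₁ ρ0 ρM ρ1 ρta hD₁ hS₂ hU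
    (by rw [mul_assoc, mul_div_cancel₀ _ hQ0.ne'])
    (by nlinarith [mul_le_mul_of_nonneg_left hxq ha0.le])
    (by nlinarith [mul_le_mul_of_nonneg_left hxU ha0.le]) j hj

/-- **SDEC form of the compound cut**: under the same hypotheses for every outer gate, `flaw (sk :: L)` is SDEC at `x` — the list form of the
sibling step for this forest, REDUCED to the SDEC of the conditioned compound with the carrier hung under it. [this work] -/
theorem sdec_flaw_cons_of_upart {x : ℝ} (hx0 : 0 < x) (hx1 : x < 1) (sk : Sib) (L : List Sib)
    (hk : sk.TreeOK x) (hL : ∀ s ∈ L, s.TreeOK x) (hne : L ≠ [])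
    (hO : ∀ (x' : ℝ) (n' M' : ℕ) (μ' : ℕ → ℝ), n' < fgates (sk :: L) → TreeBuiltN x' n' M' μ' → SDEC x' M' μ')
    (hhub : sk.q ≤ fQ L) (wU : ℝ) (hwU0 : 0 ≤ wU) (hwU1 : wU < 1)
    (hU : SDEC wU (ftop L + sk.M) (lconv (ftop L) sk.M (fbeta L) (gate sk.ρ (sk.q / fQ L))))
    (hxU : x ≤ fQ L * wU) :
    SDEC x (ftop (sk :: L)) (flaw (sk :: L)) := by
  intro a ha0 ha1 j hj
  exact decAt_gate_flaw_cons_of_upart hx0 hx1 sk L hk hL hne hO hhub ha0 ha1 wU hwU0 hwU1 hU hxU j hj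

end LawDec
end Quant
end Summit.CriticalPhenomena.PercolationContinuityZ3.Theorems
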